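import Summits.AtomisticToContinuum.BoseEinsteinCondensation.Theorems.BECSwapNoCatastropheAbsTorusDefs
import Literature.MathematicalPhysics.QuantumManyBody.PeriodicWeightedMaxFormBound
import Literature.MathematicalPhysics.QuantumManyBody.PeriodicWeightedMaxFormGroundStates
import HarnessLib

/-!
# Crux `TorusHalfSwapOverlap`, line `registered` (v7, truncation split): stub B `stub_absMaxFormBoundL1`

B. Simon's `L¹` theorem on the ABSOLUTE class [Simon1979Forms, Thm. 2.1; ReedSimonIV1978, Thm. XIII.64]:
for `L > 0` and a measurable weight `0 ≤ W' ∈ L¹([0,L)^{3N})`, the plain `C¹` periodic functions realise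
the bottom of the maximal form of `-∑ⱼΔⱼ + W'` on `L²((ℝ/ℤ)^{3N})`,

  `E₀ᴬ(W') ‖η‖² ≤ maxFormW W' L η = maxFormKin L η + maxFormPotW W' L η` for EVERY `η ∈ L²((ℝ/ℤ)^{3N})`,

`E₀ᴬ(W') = absGroundStateEnergyW W' L` (infimum of `absEnergyW W' L` over `AbsAdm N L`: `C¹`, periodic,
cell-normalised, NO Bose symmetry). The transport dictionary `Ψ ↦ η_Ψ = L^{3N/2} (Ψ ∘ fromUnitTorusN L)`
(neighbour stub D) is taken as the hypothesis `hD`. Symmetry-free twin of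
`Literature/MathematicalPhysics/QuantumManyBody/PeriodicWeightedMaxFormBound.lean`:
* `absGroundStateEnergyW_mul_le_maxFormW_sum_smul` — the absolute core variational principle for
  trigonometric polynomials `P = ∑_{n ∈ S} aₙ eₙ` (realised through `hD` by the plain `C¹` periodic function
  `L^{-3N/2} ∑ aₙ e^{2πi n·X/L}`, then normalised);
* `exists_trigPoly_maxFormW_approx` — bounded classes are approximated in the maximal form by trigonometric
  polynomials (box kernels, dominated convergence of the potential energies);
* `absGroundStateEnergyW_mul_le_maxFormW_of_bound` — the bound for bounded classes;
* `stub_absMaxFormBoundL1` — the bound for every `η` (Lipschitz clamp truncation).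
-/

noncomputable section

namespace Summit.AtomisticToContinuum.BoseEinsteinCondensation.Cruxes.TorusHalfSwapOverlap.TruncationSplit

open MeasureTheory Filter Topology UnitAddTorus
open scoped ENNReal NNReal InnerProductSpace ComplexConjugate
open Literature.MathematicalPhysics.QuantumManyBody.BoseGas
open Literature.Analysis.FunctionSpaces Literature.Analysis.OperatorTheory
open Summit.AtomisticToContinuum.BoseEinsteinCondensation.AbsTorus

-- The measure on `ℝ/ℤ` is the Haar PROBABILITY measure, as in `PeriodicFormDomain.lean`.
attribute [local instance] formDomain_measureSpace formDomain_isProbabilityMeasure formDomain_isProbabilityMeasure_pi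

/-- Local notation for the Hilbert space `H = L²((ℝ/ℤ)^{3N})`. -/
local notation "L2T " N':max => Lp ℂ 2 (volume : Measure (UnitAddTorus (Fin N' × Fin 3)))

variable {N : ℕ} {L : ℝ}

/-! ### The absolute core variational principle for trigonometric polynomials -/

/-- **The absolute core variational principle for trigonometric polynomials.** Under the transport
dictionary `hD` (plain `C¹` periodic `Ψ ↦ η_Ψ = L^{3N/2} (Ψ ∘ fromUnitTorusN L)` with cell norm, spectral kinetic
energy `∫|∇Ψ|²` and potential energy `∫ W|Ψ|²`): for `L > 0`, a measurable weight `W'`, a finite set of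
frequencies `S` and coefficients `a`, with `P = ∑_{n ∈ S} aₙ eₙ`,
`E₀ᴬ(W') · ‖P‖² ≤ maxFormKin L P + maxFormPotW W' L P` (`P = η_Ψ` for `Ψ = L^{-3N/2} ∑ aₙ e^{2πi n·X/L}`; either
`P = 0` or `Ψ/‖P‖ ∈ AbsAdm N L`). [cite: ReedSimonIV1978, Thm. XIII.64] -/
theorem absGroundStateEnergyW_mul_le_maxFormW_sum_smul
    (hD : ∀ (N : ℕ) (L : ℝ), 0 < L → ∀ Ψ : Config N → ℂ, ContDiff ℝ 1 Ψ → IsTorusPeriodic L Ψ →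
      ∃ ηΨ : Lp ℂ 2 (volume : Measure (UnitAddTorus (Fin N × Fin 3))),
        (∀ᵐ t ∂(volume : Measure (UnitAddTorus (Fin N × Fin 3))),
          (ηΨ : UnitAddTorus (Fin N × Fin 3) → ℂ) t = (cellScale N L : ℂ) * Ψ (fromUnitTorusN L t)) ∧
        ENNReal.ofReal (‖ηΨ‖ ^ 2) = ∫⁻ X in cellN N L, (‖Ψ X‖₊ : ℝ≥0∞) ^ 2 ∧
        maxFormKin L ηΨ = ∫⁻ X in cellN N L, kineticDensity Ψ X ∧
        ∀ W : Config N → ℝ≥0∞, Measurable W →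
          maxFormPotW W L ηΨ = ∫⁻ X in cellN N L, W X * (‖Ψ X‖₊ : ℝ≥0∞) ^ 2)
    (hL : 0 < L) {W' : Config N → ℝ≥0∞} (hW'm : Measurable W')
    (S : Finset (Fin N × Fin 3 → ℤ)) (a : (Fin N × Fin 3 → ℤ) → ℂ) :
    absGroundStateEnergyW W' L * ENNReal.ofReal (‖∑ n ∈ S, a n • (mFourierLp 2 n : L2T N)‖ ^ 2) ≤
      maxFormKin L (∑ n ∈ S, a n • (mFourierLp 2 n : L2T N)) +
        maxFormPotW W' L (∑ n ∈ S, a n • (mFourierLp 2 n : L2T N)) := by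
  -- the trigonometric polynomial as a plain `C¹` periodic function of the configuration
  set Ψ : Config N → ℂ := fun X => ((cellScale N L)⁻¹ : ℂ) * ∑ n ∈ S, a n * cellWaveN L n X with hΨ
  have hΨC1 : ContDiff ℝ 1 Ψ :=
    contDiff_const.mul (ContDiff.sum fun n _ => contDiff_const.mul (contDiff_cellWaveN L n))
  have hΨper : IsTorusPeriodic L Ψ := by
    intro X i k
    simp only [hΨ, cellWaveN_periodic hL.ne' _ X i k]
  obtain ⟨ηΨ, hae, hnorm, hkin, hpot⟩ := hD N L hL Ψ hΨC1 hΨper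
  -- its torus class is the finite Fourier sum
  have hsc : cellScale N L ≠ 0 := by
    rw [cellScale]; exact (Real.sqrt_pos.2 (by positivity)).ne'
  have hηP : ηΨ = ∑ n ∈ S, a n • (mFourierLp 2 n : L2T N) := by
    refine Lp.ext ?_
    filter_upwards [hae, HaarTorus.coeFn_sum_smul_mFourierLp S a] with t h1 h2
    rw [h1, h2]
    simp only [hΨ, cellWaveN, toUnitTorusN_fromUnitTorusN hL.ne', ← mul_assoc]
    rw [mul_inv_cancel₀ (by exact_mod_cast hsc), one_mul]
  rw [← hηP, hkin, hpot W' hW'm]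
  -- normalise: either `ηΨ = 0`, or `Ψ/‖ηΨ‖` is absolutely admissible
  set c : ℝ := ‖ηΨ‖ with hc
  rcases eq_or_lt_of_le (show 0 ≤ c from norm_nonneg _) with h0 | hpos
  · rw [← h0]
    simp
  have hsq : ∀ z : ℂ, ((‖((c⁻¹ : ℝ) : ℂ) * z‖₊ : ℝ≥0∞)) ^ 2 = ENNReal.ofReal (c⁻¹ ^ 2) * (‖z‖₊ : ℝ≥0∞) ^ 2 :=
    fun z => by
    rw [coe_nnnorm_sq_eq_ofReal, coe_nnnorm_sq_eq_ofReal, norm_mul, Complex.norm_real,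
      Real.norm_of_nonneg (inv_nonneg.2 hpos.le), mul_pow, ENNReal.ofReal_mul (sq_nonneg _)]
  have hcc : ENNReal.ofReal (c⁻¹ ^ 2) * ENNReal.ofReal (c ^ 2) = 1 := by
    rw [← ENNReal.ofReal_mul (sq_nonneg _), ← mul_pow, inv_mul_cancel₀ hpos.ne', one_pow, ENNReal.ofReal_one]
  have hΦ : AbsAdm N L (fun X => ((c⁻¹ : ℝ) : ℂ) * Ψ X) := by
    refine ⟨contDiff_const.mul hΨC1, ?_, ?_⟩
    · intro X i k
      dsimp only
      rw [hΨper X i k]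
    · simp only [hsq]
      rw [lintegral_const_mul' _ _ ENNReal.ofReal_ne_top, ← hnorm, hcc]
  have hEΦ : absEnergyW W' L (fun X => ((c⁻¹ : ℝ) : ℂ) * Ψ X) = ENNReal.ofReal (c⁻¹ ^ 2) *
      ((∫⁻ X in cellN N L, kineticDensity Ψ X) + ∫⁻ X in cellN N L, W' X * (‖Ψ X‖₊ : ℝ≥0∞) ^ 2) := by
    rw [absEnergyW_def, ← lintegral_add_left (measurable_kineticDensity_any Ψ),
      ← lintegral_const_mul' _ _ ENNReal.ofReal_ne_top]
    refine lintegral_congr fun X => ?_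
    rw [kineticDensity_const_mul hΨC1 _ (inv_nonneg.2 hpos.le), hsq]
    ring
  have hE := (absGroundStateEnergyW_le (W := W') hΦ).trans_eq hEΦ
  -- multiply through by `c²`
  calc absGroundStateEnergyW W' L * ENNReal.ofReal (c ^ 2)
      ≤ ENNReal.ofReal (c⁻¹ ^ 2) * ((∫⁻ X in cellN N L, kineticDensity Ψ X) +
          ∫⁻ X in cellN N L, W' X * (‖Ψ X‖₊ : ℝ≥0∞) ^ 2) * ENNReal.ofReal (c ^ 2) := mul_le_mul_left hE _
    _ = _ := by rw [mul_comm (ENNReal.ofReal (c⁻¹ ^ 2)), mul_assoc, hcc, mul_one]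

/-! ### Bounded classes: approximation by trigonometric polynomials -/

/-- **Bounded classes are approximated in the maximal form by trigonometric polynomials.** Let `L > 0`, `W`
a measurable weight with `∫_{[0,L)^{3N}} W < ∞`, and `f ∈ L²((ℝ/ℤ)^{3N})` with `‖f‖ ≤ C` a.e. For every `ε > 0`
there is a trigonometric polynomial `P = ∑_{n ∈ S} aₙ eₙ` whose spectral kinetic energy is at most that of `f`,
with `maxFormPotW W L P ≤ maxFormPotW W L f + ε` and `‖P - f‖ ≤ ε` (box-kernel smoothing with dominated Fourier
coefficients; dominated convergence of the potential energies along an a.e.-convergent subsequence).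
[cite: ReedSimonIV1978, Thm. XIII.64] -/
theorem exists_trigPoly_maxFormW_approx (hL : 0 < L) {W : Config N → ℝ≥0∞} (hWm : Measurable W)
    (hW : ∫⁻ X in cellN N L, W X ≠ ⊤) (f : L2T N) {C : ℝ}
    (hC : ∀ᵐ t ∂(volume : Measure (UnitAddTorus (Fin N × Fin 3))), ‖(f : UnitAddTorus (Fin N × Fin 3) → ℂ) t‖ ≤ C)
    {ε : ℝ} (hε : 0 < ε) :
    ∃ (S : Finset (Fin N × Fin 3 → ℤ)) (a : (Fin N × Fin 3 → ℤ) → ℂ),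
      maxFormKin L (∑ m ∈ S, a m • (mFourierLp 2 m : L2T N)) ≤ maxFormKin L f ∧
      maxFormPotW W L (∑ m ∈ S, a m • (mFourierLp 2 m : L2T N)) ≤ maxFormPotW W L f + ENNReal.ofReal ε ∧
      ‖(∑ m ∈ S, a m • (mFourierLp 2 m : L2T N)) - f‖ ≤ ε := by
  classical
  have hWtm : Measurable fun t : UnitAddTorus (Fin N × Fin 3) => W (fromUnitTorusN L t) :=
    hWm.comp (measurable_fromUnitTorusN L)
  have hWtint : ∫⁻ t, W (fromUnitTorusN L t) ≠ ⊤ := lintegral_weight_fromUnitTorusN_ne_top hL hWm hW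
  -- the approximating trigonometric polynomials
  have hδ : ∀ j : ℕ, (0 : ℝ) < 1 / ((j : ℝ) + 1) := fun j => by positivity
  choose R m hm1 _hmσ hsup hdist using fun j : ℕ => HaarTorus.exists_trigPoly_approx_of_bound f hC (hδ j)
  set box : ℕ → Finset (Fin N × Fin 3 → ℤ) := fun j =>
    Fintype.piFinset fun _ : Fin N × Fin 3 => Finset.Icc (-(R j : ℤ)) (R j) with hbox
  set a : ℕ → (Fin N × Fin 3 → ℤ) → ℂ := fun j n => m j n * mFourierCoeff f n with ha
  set P : ℕ → L2T N := fun j => ∑ n ∈ box j, a j n • (mFourierLp 2 n : L2T N) with hP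
  -- (i) `P j → f` in `L²`
  have hPf : Tendsto P atTop (𝓝 f) := by
    rw [tendsto_iff_norm_sub_tendsto_zero]
    exact squeeze_zero (fun j => norm_nonneg _) (fun j => hdist j) tendsto_one_div_add_atTop_nhds_zero_nat
  -- (ii) `P j` is bounded by `C + 1` a.e.
  have hPbd : ∀ j, ∀ᵐ t ∂(volume : Measure (UnitAddTorus (Fin N × Fin 3))),
      ‖(P j : UnitAddTorus (Fin N × Fin 3) → ℂ) t‖ ≤ C + 1 := fun j => by
    filter_upwards [HaarTorus.coeFn_sum_smul_mFourierLp (box j) (a j)] with t ht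
    simp only [hP]
    rw [ht]
    refine (hsup j t).trans (add_le_add le_rfl ?_)
    rw [div_le_one (by positivity)]
    linarith [(Nat.cast_nonneg j : (0 : ℝ) ≤ j)]
  -- (iii) the kinetic energies are dominated by that of `f`
  have hkin : ∀ j, maxFormKin L (P j) ≤ maxFormKin L f := fun j => by
    refine ENNReal.tsum_le_tsum fun n => mul_le_mul_right ?_ _
    have hle : (‖⟪(mFourierLp 2 n : L2T N), P j⟫_ℂ‖₊ : ℝ≥0∞) ≤ ‖⟪(mFourierLp 2 n : L2T N), f⟫_ℂ‖₊ := by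
      refine ENNReal.coe_le_coe.2 ?_
      simp only [hP]
      rw [HaarTorus.inner_mFourierLp_sum_smul, HaarTorus.inner_mFourierLp_eq_mFourierCoeff]
      split_ifs
      · simp only [ha, nnnorm_mul]
        refine mul_le_of_le_one_left bot_le (NNReal.coe_le_coe.1 ?_)
        rw [coe_nnnorm, NNReal.coe_one]
        exact hm1 j n
      · simp
    exact pow_le_pow_left' hle 2
  -- (iv) the potential energies converge along an a.e.-convergent subsequence
  obtain ⟨φ, hφ, hae⟩ := (tendstoInMeasure_of_tendsto_Lp hPf).exists_seq_tendsto_ae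
  have hpot : Tendsto (fun i => maxFormPotW W L (P (φ i))) atTop (𝓝 (maxFormPotW W L f)) := by
    refine tendsto_lintegral_of_dominated_convergence'
      (fun t => W (fromUnitTorusN L t) * ENNReal.ofReal ((C + 1) ^ 2))
      (fun i => hWtm.aemeasurable.mul
        ((Lp.aestronglyMeasurable (P (φ i))).aemeasurable.nnnorm.coe_nnreal_ennreal.pow_const 2)) ?_ ?_ ?_
    · intro i
      filter_upwards [hPbd (φ i)] with t ht
      refine mul_le_mul_right ?_ _
      rw [coe_nnnorm_sq_eq_ofReal]
      exact ENNReal.ofReal_le_ofReal (pow_le_pow_left₀ (norm_nonneg _) ht 2)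
    · rw [lintegral_mul_const _ hWtm]
      exact ENNReal.mul_ne_top hWtint ENNReal.ofReal_ne_top
    · filter_upwards [hae, ae_lt_top hWtm hWtint] with t ht hWfin
      have hsq : Tendsto (fun i => (‖(P (φ i) : UnitAddTorus (Fin N × Fin 3) → ℂ) t‖₊ : ℝ≥0∞) ^ 2) atTop
          (𝓝 ((‖(f : UnitAddTorus (Fin N × Fin 3) → ℂ) t‖₊ : ℝ≥0∞) ^ 2)) :=
        ((ENNReal.continuous_pow 2).tendsto _).comp ((ENNReal.continuous_coe.tendsto _).comp ht.nnnorm)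
      exact ENNReal.Tendsto.const_mul hsq (Or.inr hWfin.ne)
  -- (v) pick an index far enough along the subsequence
  have hev1 : ∀ᶠ i in atTop, maxFormPotW W L (P (φ i)) ≤ maxFormPotW W L f + ENNReal.ofReal ε := by
    by_cases htop : maxFormPotW W L f = ⊤
    · exact Eventually.of_forall fun i => by rw [htop, top_add]; exact le_top
    · exact ((tendsto_order.1 hpot).2 _ (ENNReal.lt_add_right htop (by simpa using hε))).mono fun i hi => hi.le
  have hev2 : ∀ᶠ i in atTop, ‖P (φ i) - f‖ ≤ ε :=
    (tendsto_iff_norm_sub_tendsto_zero.1 (hPf.comp hφ.tendsto_atTop)).eventually (Iic_mem_nhds hε)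
  obtain ⟨i, hi1, hi2⟩ := (hev1.and hev2).exists
  have h5 := hkin (φ i)
  simp only [hP] at h5 hi1 hi2
  exact ⟨box (φ i), a (φ i), h5, hi1, hi2⟩

/-- **The maximal-form bound on the absolute class for bounded classes.** Under the transport dictionary
`hD`: for `L > 0`, a measurable weight `W'` with `∫_{[0,L)^{3N}} W' < ∞`, and `f ∈ L²((ℝ/ℤ)^{3N})` with
`‖f‖ ≤ C` a.e., `E₀ᴬ(W') · ‖f‖² ≤ maxFormKin L f + maxFormPotW W' L f`. [cite: ReedSimonIV1978, Thm. XIII.64] -/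
theorem absGroundStateEnergyW_mul_le_maxFormW_of_bound
    (hD : ∀ (N : ℕ) (L : ℝ), 0 < L → ∀ Ψ : Config N → ℂ, ContDiff ℝ 1 Ψ → IsTorusPeriodic L Ψ →
      ∃ ηΨ : Lp ℂ 2 (volume : Measure (UnitAddTorus (Fin N × Fin 3))),
        (∀ᵐ t ∂(volume : Measure (UnitAddTorus (Fin N × Fin 3))),
          (ηΨ : UnitAddTorus (Fin N × Fin 3) → ℂ) t = (cellScale N L : ℂ) * Ψ (fromUnitTorusN L t)) ∧
        ENNReal.ofReal (‖ηΨ‖ ^ 2) = ∫⁻ X in cellN N L, (‖Ψ X‖₊ : ℝ≥0∞) ^ 2 ∧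
        maxFormKin L ηΨ = ∫⁻ X in cellN N L, kineticDensity Ψ X ∧
        ∀ W : Config N → ℝ≥0∞, Measurable W →
          maxFormPotW W L ηΨ = ∫⁻ X in cellN N L, W X * (‖Ψ X‖₊ : ℝ≥0∞) ^ 2)
    (hL : 0 < L) {W' : Config N → ℝ≥0∞} (hW'm : Measurable W') (hW' : ∫⁻ X in cellN N L, W' X ≠ ⊤)
    (f : L2T N) {C : ℝ}
    (hC : ∀ᵐ t ∂(volume : Measure (UnitAddTorus (Fin N × Fin 3))), ‖(f : UnitAddTorus (Fin N × Fin 3) → ℂ) t‖ ≤ C) :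
    absGroundStateEnergyW W' L * ENNReal.ofReal (‖f‖ ^ 2) ≤ maxFormKin L f + maxFormPotW W' L f := by
  classical
  -- trivial when `f = 0`
  by_cases hf0 : ‖f‖ = 0
  · rw [hf0]; simp
  -- the approximants at accuracy `1/(j+1)`
  have hδ : ∀ j : ℕ, (0 : ℝ) < 1 / ((j : ℝ) + 1) := fun j => by positivity
  choose S a hkin hpot hdist using fun j : ℕ => exists_trigPoly_maxFormW_approx hL hW'm hW' f hC (hδ j)
  have hcore := fun j : ℕ => (absGroundStateEnergyW_mul_le_maxFormW_sum_smul hD hL hW'm (S j) (a j)).trans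
    ((add_le_add (hkin j) (hpot j)).trans_eq (add_assoc _ _ _).symm)
  set Q : ℝ≥0∞ := maxFormKin L f + maxFormPotW W' L f with hQ
  have hPf : Tendsto (fun j => ∑ m ∈ S j, a j m • (mFourierLp 2 m : L2T N)) atTop (𝓝 f) := by
    rw [tendsto_iff_norm_sub_tendsto_zero]
    exact squeeze_zero (fun j => norm_nonneg _) (fun j => hdist j) tendsto_one_div_add_atTop_nhds_zero_nat
  have hnorm : Tendsto (fun j => absGroundStateEnergyW W' L *
      ENNReal.ofReal (‖∑ m ∈ S j, a j m • (mFourierLp 2 m : L2T N)‖ ^ 2)) atTop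
      (𝓝 (absGroundStateEnergyW W' L * ENNReal.ofReal (‖f‖ ^ 2))) := by
    have h1 : Tendsto (fun j => ‖∑ m ∈ S j, a j m • (mFourierLp 2 m : L2T N)‖ ^ 2) atTop (𝓝 (‖f‖ ^ 2)) :=
      ((continuous_norm.tendsto f).comp hPf).pow 2
    refine ENNReal.Tendsto.const_mul ((ENNReal.continuous_ofReal.tendsto _).comp h1) (Or.inl ?_)
    rw [Ne, ENNReal.ofReal_eq_zero, not_le]
    exact pow_pos (lt_of_le_of_ne (norm_nonneg f) (Ne.symm hf0)) 2
  have hrhs : Tendsto (fun j : ℕ => Q + ENNReal.ofReal (1 / ((j : ℝ) + 1))) atTop (𝓝 Q) := by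
    have h := (ENNReal.continuous_ofReal.tendsto _).comp tendsto_one_div_add_atTop_nhds_zero_nat
    rw [ENNReal.ofReal_zero] at h
    have h2 := h.const_add Q
    rwa [add_zero] at h2
  exact le_of_tendsto_of_tendsto' hnorm hrhs hcore

/-! ### The maximal-form bound on the absolute class -/

/-- **B. Simon's `L¹` theorem on the absolute class** (stub B of the truncation split). Under the transport
dictionary for plain `C¹` periodic functions (`Ψ ↦ η_Ψ = L^{3N/2} (Ψ ∘ fromUnitTorusN L)` with cell norm,
`maxFormKin = ∫|∇Ψ|²`, `maxFormPotW W = ∫ W|Ψ|²`): for `L > 0`, a measurable weight `W'` with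
`∫_{[0,L)^{3N}} W' < ∞` and EVERY `η ∈ L²((ℝ/ℤ)^{3N})`,
`absGroundStateEnergyW W' L · ‖η‖² ≤ maxFormW W' L η` — the plain `C¹` periodic functions realise the bottom of
the maximal form of `-∑ⱼΔⱼ + W'` (trigonometric polynomials for bounded classes, then Lipschitz clamp truncation
and dominated convergence of the norms). [cite: ReedSimonIV1978, Thm. XIII.64] -/
theorem stub_absMaxFormBoundL1 :
    (∀ (N : ℕ) (L : ℝ), 0 < L → ∀ Ψ : Config N → ℂ, ContDiff ℝ 1 Ψ → IsTorusPeriodic L Ψ →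
      ∃ ηΨ : Lp ℂ 2 (volume : Measure (UnitAddTorus (Fin N × Fin 3))),
        (∀ᵐ t ∂(volume : Measure (UnitAddTorus (Fin N × Fin 3))),
          (ηΨ : UnitAddTorus (Fin N × Fin 3) → ℂ) t = (cellScale N L : ℂ) * Ψ (fromUnitTorusN L t)) ∧
        ENNReal.ofReal (‖ηΨ‖ ^ 2) = ∫⁻ X in cellN N L, (‖Ψ X‖₊ : ℝ≥0∞) ^ 2 ∧
        maxFormKin L ηΨ = ∫⁻ X in cellN N L, kineticDensity Ψ X ∧
        ∀ W : Config N → ℝ≥0∞, Measurable W →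
          maxFormPotW W L ηΨ = ∫⁻ X in cellN N L, W X * (‖Ψ X‖₊ : ℝ≥0∞) ^ 2) →
    ∀ (N : ℕ) (L : ℝ), 0 < L → ∀ W' : Config N → ℝ≥0∞, Measurable W' → (∫⁻ X in cellN N L, W' X) ≠ ⊤ →
      ∀ η : Lp ℂ 2 (volume : Measure (UnitAddTorus (Fin N × Fin 3))),
        absGroundStateEnergyW W' L * ENNReal.ofReal (‖η‖ ^ 2) ≤ maxFormW W' L η := by
  intro hD N L hL W' hW'm hW' η
  rw [maxFormW_def]
  set f : ℕ → L2T N := fun k => (lipschitzWith_clampC (k : ℝ)).compLp (clampC_zero (Nat.cast_nonneg k)) η with hf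
  -- the bounded case for each truncation, whose energies are dominated by those of `η`
  have hk : ∀ k : ℕ, absGroundStateEnergyW W' L * ENNReal.ofReal (‖f k‖ ^ 2) ≤
      maxFormKin L η + maxFormPotW W' L η := fun k =>
    (absGroundStateEnergyW_mul_le_maxFormW_of_bound hD hL hW'm hW' (f k) (ae_norm_clampLp_le η k)).trans
      (add_le_add (tsum_kinetic_clampLp_le η k)
        (lintegral_pot_clampLp_le η k fun t => W' (fromUnitTorusN L t)))
  -- `‖f k‖² → ‖η‖²` as `ℝ≥0∞`-integrals
  have hnorm : ∀ x : L2T N, ENNReal.ofReal (‖x‖ ^ 2) =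
      ∫⁻ t, ((‖(x : UnitAddTorus (Fin N × Fin 3) → ℂ) t‖₊ : ℝ≥0∞)) ^ 2 := fun x => by
    rw [(norm_Lp_two_sq_eq_toReal x).1, ENNReal.ofReal_toReal (norm_Lp_two_sq_eq_toReal x).2]
  simp only [hnorm] at hk ⊢
  by_cases h0 : ∫⁻ t, ((‖(η : UnitAddTorus (Fin N × Fin 3) → ℂ) t‖₊ : ℝ≥0∞)) ^ 2 = 0
  · rw [h0, mul_zero]
    exact zero_le
  have hlim := ENNReal.Tendsto.const_mul (tendsto_lintegral_clampLp_sq η) (Or.inl h0)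
    (a := absGroundStateEnergyW W' L)
  exact le_of_tendsto' hlim hk

end Summit.AtomisticToContinuum.BoseEinsteinCondensation.Cruxes.TorusHalfSwapOverlap.TruncationSplit

end
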